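import Mathlib
import Literature.Combinatorics.Additive.TripleProductProperty
import Literature.Computability.AlgebraicComplexity.MatrixMultiplicationExponent
import HarnessLib

/-!
# Finite matrix multiplication algorithms from infinite groups (BCGPU 2024): separating functions
# and the cost theorem (statements only)

Topic `Literature/Computability/AlgebraicComplexity` (family `MatrixMultiplication`). Requested by
route `MatrixMultiplication/NilpotentLieHosts` (its target, the cruxes `HeisenbergThresholdDesigns`,
`HigherStepThresholdDesigns`, and the support `HostingBound` inline Definition 2.1 below and rely on
Theorem 2.2 / Remark 2.4 of the source); also the natural ancestor fact for every other
"infinite-group host" route. The finite-group case (Cohn–Umans 2003 Thm. 4.1 = CKSU 2005 Thm. 1.8) is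
the tree's `CKSU2005_thm18` (`CohnUmansTPP.lean`); this file vendors the infinite-group generalisation
as printed.

## The printed statements (J. Blasiak, H. Cohn, J. A. Grochow, K. Pratt, C. Umans, *Finite matrix
multiplication algorithms from infinite groups*, arXiv:2410.14905 (ITCS 2025); held text pp. 10–13)

"**Definition 2.1.** Given subsets `X, Y, Z ⊆ G` of a group `G`, a set of separating functions for
`(X, Y, Z)` is a collection of functions `{f_{x,z} : G → ℂ | x ∈ X, z ∈ Z}` such that `f_{x,z}(g) = 1`
if `g = x z⁻¹`, and `0` if `g ∈ X Y⁻¹ Y Z⁻¹ ∖ {x z⁻¹}`."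
"Given a finite-dimensional representation `ρ : G → GL_n(ℂ)`, a representative function of `G`
associated to `ρ` is any function `G → ℂ` that is in the linear span of the functions
`{(g ↦ ρ(g)_{i,j}) | i, j ∈ [n]}`. […] If `I` is a set of representations, we write `RepFun(I)` for
the ℂ-linear span of all the representative functions of the representations in `I`."
"**Theorem 2.2.** Let `G` be a group (not necessarily finite), with finite subsets `X, Y, Z`
satisfying the TPP. If `R_sep` is a finite set of finite-dimensional complex representations of `G`
such that `RepFun(R_sep)` contains a set of separating functions for `(X, Y, Z)`, then
`(|X| |Y| |Z|)^{ω/3} ≤ ∑_{ρ ∈ R_sep} (dim ρ)^ω`. […] If `G` is a finite group, we may take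
`R_sep = Irr(G)` […] recovering the original theorem for finite groups [CU03, Theorem 4.1]."
"**Remark 2.4.** The image `ρ(ℂ[G])` is the full `d_ρ × d_ρ` matrix ring if and only if `ρ` is an
irreducible representation. In particular, although we will not take advantage of this in the
present paper, we note that when `ρ` is not irreducible, we can replace `rk⟨d_ρ,d_ρ,d_ρ⟩` (or
`d_ρ^ω`) with the tensor rank of multiplying matrices in the image of `ρ`, which may only be a
subspace of all matrices."

## Lean rendering

* `IsSeparatingFamily X Y Z f` — Def. 2.1 for a family `f : G → G → (G → ℂ)` indexed by all pairs
  (only `x ∈ X`, `z ∈ Z` matter): value `1` at `x z⁻¹`, value `0` at every other point of the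
  product set `X Y⁻¹ Y Z⁻¹` (written with explicit witnesses `x' y⁻¹ y' z'⁻¹`).
* `repFun ρ` — `RepFun` of a finite family of matrix representations `ρ i : G →* GL (Fin (n i)) ℂ`:
  the ℂ-span in `G → ℂ` of the matrix-coefficient functions `g ↦ (ρ i g)_{a b}`.
* `BCGPU2024_thm_2_2` — Thm. 2.2 verbatim: TPP (the tree's `TripleProductProperty`, CU03 Def. 2.1,
  i.e. the source's own §1 wording `x x'⁻¹ y y'⁻¹ z z'⁻¹ = 1 ⟹ x = x', y = y', z = z'`) plus
  separating functions inside `repFun ρ` give `(|X||Y||Z|)^{ω/3} ≤ ∑ i (n i)^ω`, with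
  `ω = omega ℂ` (the tree's exponent over `ℂ`). A named fact, **REFUTED as vendored** (see
  "Verdict" below): the printed proof makes `⟨|X|,|Y|,|Z|⟩` a restriction of block-diagonal matrix
  multiplication in `⊕_ρ M_{d_ρ}(ℂ)` via the separating functions, then applies the asymptotic sum
  inequality — and its first step needs the TPP in a different (embedding) form.

## Verdict (2026-08-15, provefact seat): `BCGPU2024_thm_2_2` is false as vendored; corrected and proved next door

The statement below is a faithful copy of the print, and the print carries a convention slip. Its
§1 (p. 2) defines the TPP in the right-quotient form above (= `TripleProductProperty`), while the
proof of Thm. 2.2 (pp. 12–13) rests on eq. (2.1) (p. 10: "the TPP implies that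
`Ā · B̄ = ∑ (AB)[x,z] (x z⁻¹) + E`" with `E` supported on `X Y⁻¹ Y Z⁻¹ ∖ X Z⁻¹`), which needs the
EMBEDDING form `x y⁻¹ y' z'⁻¹ = x₀ z₀⁻¹ ⟹ x = x₀, y = y', z' = z₀` (equivalently the right-quotient
TPP of `(X⁻¹, Y⁻¹, Z⁻¹)`; it is the form the source itself verifies in the proof of Lemma 2.11,
p. 22). The two forms agree when `X, Y, Z` are closed under inverses (e.g. subgroups — all the
paper's applications) and in abelian groups, but not in general, and with the right-quotient form
Thm. 2.2 fails: in `S₃`, with `b` a transposition, `c` a 3-cycle, `a = b c`, `X = {1, a}`, `Y = {1}`,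
`Z = {b, c}`, the right-quotient TPP holds, yet `X Y⁻¹ Y Z⁻¹ = X Z⁻¹ = {b, c⁻¹}` has just two
elements, of opposite signs, so `f_{x,z} = (1 + sgn(x z⁻¹)·sgn)/2` is a set of separating functions
inside `RepFun{triv, sgn}` and the conclusion would read `4^{ω/3} ≤ 1^ω + 1^ω = 2`, i.e. `ω ≤ 3/2`,
contradicting `ω ≥ 2`.
* Formal refutation: `BCGPU2024_thm_2_2_false : ¬ BCGPU2024_thm_2_2` in
  `BCGPUInfiniteGroupsCounterexample.lean` (this example, `Equiv.Perm (ULift (Fin 3))`, every universe).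
* Corrected statement (TPP in embedding form, everything else verbatim) and its PROOF along the
  printed lines: `BCGPU2024_thm_2_2_corrected`, `BCGPU2024_thm_2_2_corrected_holds` in
  `BCGPUInfiniteGroupsProofs.lean`, with the bridge
  `tpp_embedding_of_tripleProductProperty_of_inv_mem` (right-quotient TPP + inverse-closed sets ⟹
  embedding form) and the "In particular" corollary `BCGPU2024_thm_2_2_corrected.le_mul_rpow`.
The declaration below is kept byte-for-byte (it is the statement the refutation negates, its only
user); never take `(h : BCGPU2024_thm_2_2)` as a hypothesis — use `BCGPU2024_thm_2_2_corrected_holds`.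

What is NOT here: the border-rank version Thm. 2.6 and Lemma 2.11 (Lie groups, ε-parametrised
families), the constructions of §3 (Thm. C), and Remark 2.4's image-algebra refinement as a
separate fact — route `NilpotentLieHosts` states that refinement in-house as its support item
`HostingBound` (provable over the tree's `structureTensor` / `asymptoticRank`).

## References

* [BlasiakCohnGrochowPrattUmans2024] J. Blasiak, H. Cohn, J. A. Grochow, K. Pratt, C. Umans,
  *Finite matrix multiplication algorithms from infinite groups*, arXiv:2410.14905 — Def. 2.1,
  Thm. 2.2, Rem. 2.3–2.4 (pp. 10–13).
* [CohnUmans2003] H. Cohn, C. Umans, FOCS 2003 — Def. 2.1 (TPP), Thm. 4.1.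
-/

noncomputable section

open scoped BigOperators

namespace Literature.Computability.AlgebraicComplexity

open Literature.Combinatorics.Additive (TripleProductProperty)

universe u

variable {G : Type u} [Group G]

/-- **Separating functions** (BCGPU 2024, Def. 2.1): for `x ∈ X`, `z ∈ Z` the function `f x z : G → ℂ`
takes the value `1` at `x z⁻¹` and `0` at every other element of the product set `X Y⁻¹ Y Z⁻¹`.
(Indexed here by all of `G × G`; only the pairs in `X × Z` are constrained.)
[cite: BlasiakCohnGrochowPrattUmans2024, Def. 2.1] -/
def IsSeparatingFamily (X Y Z : Finset G) (f : G → G → (G → ℂ)) : Prop :=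
  ∀ x ∈ X, ∀ z ∈ Z, f x z (x * z⁻¹) = 1 ∧
    ∀ x' ∈ X, ∀ y ∈ Y, ∀ y' ∈ Y, ∀ z' ∈ Z,
      x' * y⁻¹ * y' * z'⁻¹ ≠ x * z⁻¹ → f x z (x' * y⁻¹ * y' * z'⁻¹) = 0

/-- **Representative functions** `RepFun(I)` of a finite family of finite-dimensional matrix
representations `ρ i : G →* GL_{n i}(ℂ)` (BCGPU 2024, §2.1, after Procesi §8.2): the ℂ-linear span,
inside `G → ℂ`, of the matrix-coefficient functions `g ↦ (ρ i g)_{a,b}`.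
[cite: BlasiakCohnGrochowPrattUmans2024, §2.1 (RepFun)] -/
def repFun {ι : Type*} (n : ι → ℕ) (ρ : ∀ i, G →* Matrix.GeneralLinearGroup (Fin (n i)) ℂ) :
    Submodule ℂ (G → ℂ) :=
  Submodule.span ℂ
    {φ | ∃ (i : ι) (a b : Fin (n i)), φ = fun g => ((ρ i g : Matrix (Fin (n i)) (Fin (n i)) ℂ) a b)}

/-- **BCGPU 2024, Theorem 2.2** ("Let `G` be a group (not necessarily finite), with finite subsets
`X, Y, Z` satisfying the TPP. If `R_sep` is a finite set of finite-dimensional complex representations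
of `G` such that `RepFun(R_sep)` contains a set of separating functions for `(X, Y, Z)`, then
`(|X||Y||Z|)^{ω/3} ≤ ∑_{ρ ∈ R_sep} (dim ρ)^ω`."). Rendering: `R_sep` = a finite family
`ρ i : G →* GL_{n i}(ℂ)`, `i : ι`, `[Fintype ι]`; TPP = the tree's `TripleProductProperty` (CU03
Def. 2.1 = the source's §1, right-quotient form `x x'⁻¹ y y'⁻¹ z z'⁻¹ = 1 ⟹ …`; in non-abelian
groups this is NOT equivalent to the embedding form `x y⁻¹ y' z'⁻¹ = x₀ z₀⁻¹ ⟹ …` that the printed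
proof and the `MatrixMultiplication` routes use); `ω = omega ℂ`. For finite `G` and `R_sep = Irr(G)`
the print recovers CU03 Thm. 4.1 (tree: `CKSU2005_thm18`).
**Status (verdict 2026-08-15): REFUTED as vendored** — `BCGPU2024_thm_2_2_false : ¬ BCGPU2024_thm_2_2`
(`BCGPUInfiniteGroupsCounterexample.lean`, an `S₃` example; see the module docstring, "Verdict");
the corrected statement `BCGPU2024_thm_2_2_corrected` (TPP in embedding form) is PROVED as
`BCGPU2024_thm_2_2_corrected_holds` (`BCGPUInfiniteGroupsProofs.lean`). Kept verbatim as the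
statement the refutation negates; do not use it as a hypothesis.
[cite: BlasiakCohnGrochowPrattUmans2024, Thm. 2.2] -/
def BCGPU2024_thm_2_2 : Prop :=
  ∀ (G : Type u) [Group G] (X Y Z : Finset G), TripleProductProperty X Y Z →
    ∀ (ι : Type) [Fintype ι] (n : ι → ℕ) (ρ : ∀ i, G →* Matrix.GeneralLinearGroup (Fin (n i)) ℂ)
      (f : G → G → (G → ℂ)), IsSeparatingFamily X Y Z f → (∀ x ∈ X, ∀ z ∈ Z, f x z ∈ repFun n ρ) →
      ((X.card * Y.card * Z.card : ℕ) : ℝ) ^ (omega ℂ / 3) ≤ ∑ i, ((n i : ℕ) : ℝ) ^ omega ℂ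

/-- The printed corollary form: with `D = ∑ (dim ρ)²` and `d_max = max dim ρ`,
`(|X||Y||Z|)^{ω/3} ≤ D · d_max^{ω−2}` — here as the elementary step from Thm. 2.2's conclusion,
given `2 ≤ ω` (true: the tree's `omega_two_le`, taken as a hypothesis to keep this file import-light)
and a common bound `n i ≤ d` with `1 ≤ d`. [cite: BlasiakCohnGrochowPrattUmans2024, Thm. 2.2 ("In particular")] -/
theorem sum_rpow_omega_le_of_le {ι : Type} [Fintype ι] (n : ι → ℕ) {d : ℕ} (hd : 1 ≤ d)
    (hn : ∀ i, n i ≤ d) (hω : 2 ≤ omega ℂ) :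
    ∑ i, ((n i : ℕ) : ℝ) ^ omega ℂ ≤ (∑ i, ((n i : ℕ) : ℝ) ^ 2) * (d : ℝ) ^ (omega ℂ - 2) := by
  rw [Finset.sum_mul]
  refine Finset.sum_le_sum fun i _ => ?_
  have hd0 : (0 : ℝ) < d := by exact_mod_cast hd
  rcases Nat.eq_zero_or_pos (n i) with h0 | hpos
  · simp [h0, Real.zero_rpow (by linarith : omega ℂ ≠ 0)]
  · have hni : (0 : ℝ) < n i := by exact_mod_cast hpos
    have hle : ((n i : ℕ) : ℝ) ≤ d := by exact_mod_cast hn i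
    calc ((n i : ℕ) : ℝ) ^ omega ℂ = ((n i : ℕ) : ℝ) ^ (2 : ℝ) * ((n i : ℕ) : ℝ) ^ (omega ℂ - 2) := by
          rw [← Real.rpow_add hni]; ring_nf
      _ ≤ ((n i : ℕ) : ℝ) ^ (2 : ℝ) * (d : ℝ) ^ (omega ℂ - 2) := by
          gcongr
      _ = ((n i : ℕ) : ℝ) ^ 2 * (d : ℝ) ^ (omega ℂ - 2) := by norm_cast

end Literature.Computability.AlgebraicComplexity

end
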